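import Summits.HodgeConjecture.HodgeConjecture.Theorems.PadicSemiregularLiftFormalVectorBundlesAlgebraizeTowerLiftTools
import Summits.HodgeConjecture.HodgeConjecture.Theorems.PadicSemiregularLiftFormalVectorBundlesAlgebraizeKernelVectorBundle
import Summits.HodgeConjecture.HodgeConjecture.Theorems.PadicSemiregularLiftFormalVectorBundlesAlgebraizeAffineLocalizingSheafHom
import Literature.AlgebraicGeometry.KTheory.PullbackVectorBundle
import Literature.AlgebraicGeometry.Modules.AffineLocalizingClosure

/-!
# One round of lifting along an abstract tower of closed subschemes (support for EB1)

Support lemmas for stub EB1 (`stub_towerPresentation`) of line `chow-zariski-pushforward` of the crux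
`FormalVectorBundlesAlgebraize` (route `PadicSemiregularLift` of `HodgeConjecture`).

We work with an *abstract tower*: closed immersions `ι n : Y n ⟶ X`, transition maps
`t n : Y n ⟶ Y (n+1)` over `X`, modules `F n` on `Y n` with `s n : (t n)^* F (n+1) ≅ F n`, and the
transition maps `g n : ι_{n+1,*} F (n+1) ⟶ ι_{n,*} F n` of the direct images. (For the `p`-adic tower
of a `W`-flat scheme these data, and the hypotheses below, are supplied by `tower_ladder`.)

* `tower_lift`: if each `g n` is locally surjective with kernel `a_n ·`, `a_n²` kills
  `ι_{n+1,*} F (n+1)`, and `0 → Q_n → ι_{n+1,*} F(n+1) → ι_{n,*} F n → 0` is short exact with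
  `Q_n ≅ ι_{0,*} F 0`, then for `V` finite locally free with `𝓗om(V, ι_{0,*} F 0)` affine-localizing
  and `Ȟ¹(𝒰, 𝓗om(V, ι_{0,*} F 0)) = 0`, every epimorphism `V ↠ ι_{0,*} F 0` extends to a compatible
  system of epimorphisms `(ι n)^* V ↠ F n`;
* `kernel_tower`: the kernels `K n` of such a compatible system of epimorphisms onto vector bundles
  form again a tower (`(t n)^* K (n+1) ≅ K n`, compatibly with the inclusions) of vector bundles.

Everything is proved; no definitions.
-/

noncomputable section

-- Summit.HodgeConjecture.HodgeConjecture.… repeats the summit name by the D-0017 layout (Sub = Summit).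
set_option linter.dupNamespace false
-- `(𝟭 _).obj`, `(F ⋙ G).obj`, `TopCat.Presheaf` are not reducible (as in Mathlib's `AlgebraicGeometry/Modules`).
set_option backward.isDefEq.respectTransparency false

open CategoryTheory CategoryTheory.Limits AlgebraicGeometry TopologicalSpace Opposite
open Literature.AlgebraicGeometry.Motives Literature.AlgebraicGeometry.Modules
open Literature.AlgebraicGeometry.Morphisms Literature.AlgebraicGeometry.KTheory
open Summit.HodgeConjecture.HodgeConjecture.Theorems.PadicPridhamSemiregularity

universe u

namespace Summit.HodgeConjecture.HodgeConjecture.Theorems.FormalVectorBundlesAlgebraize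

variable {X : Scheme.{u}}

/-! ### Lifting an epimorphism up the tower -/

section Lift

variable {A : Type u} [CommRing A] (f : X ⟶ Spec (.of A)) {ι' : Type u} (U : ι' → X.Opens)

/-- **One round of lifting.** See the module docstring. The lift at level `n+1` is obtained from the
lift at level `n` by the Čech lifting lemma `exists_comp_eq_of_shortExact` and is an epimorphism by
the nilpotent Nakayama lemma `epi_of_comp_eq_of_locally`; the level maps `(ι n)^* V ⟶ F n` are the
transposes, compatible by `transpose_restrict`. -/
theorem tower_lift (hUaff : ∀ i, IsAffineOpen (U i)) (hUcov : ⨆ i, U i = ⊤)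
    (Y : ℕ → Scheme.{u}) (ι : ∀ n, Y n ⟶ X) [∀ n, IsClosedImmersion (ι n)]
    (t : ∀ n, Y n ⟶ Y (n + 1)) (ht : ∀ n, t n ≫ ι (n + 1) = ι n)
    (F : ∀ n, (Y n).Modules) (s : ∀ n, (Scheme.Modules.pullback (t n)).obj (F (n + 1)) ≅ F n)
    (g : ∀ n, (Scheme.Modules.pushforward (ι (n + 1))).obj (F (n + 1)) ⟶
      (Scheme.Modules.pushforward (ι n)).obj (F n))
    (hg : ∀ n, g n = (Scheme.Modules.pushforward (ι (n + 1))).map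
        ((Scheme.Modules.pullbackPushforwardAdjunction (t n)).unit.app (F (n + 1)) ≫
          (Scheme.Modules.pushforward (t n)).map (s n).hom) ≫
        (Scheme.Modules.pushforwardComp (t n) (ι (n + 1))).hom.app (F n) ≫
        (Scheme.Modules.pushforwardCongr (ht n)).hom.app (F n))
    (a : ℕ → ℕ)
    (hloc : ∀ (n : ℕ) (x : X), ∃ U' : X.Opens, x ∈ U' ∧ ∀ W : X.Opens, IsAffineOpen W → W ≤ U' →
      Function.Surjective ((g n).app W) ∧ ∀ y, (g n).app W y = 0 ↔ ∃ y', y = a n • y')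
    (hkill : ∀ (n : ℕ) (W : X.Opens)
      (y : Γ((Scheme.Modules.pushforward (ι (n + 1))).obj (F (n + 1)), W)), (a n * a n) • y = 0)
    (hSES : ∀ n, ∃ (Q : X.Modules) (j : Q ⟶ (Scheme.Modules.pushforward (ι (n + 1))).obj (F (n + 1)))
      (w : j ≫ g n = 0), (ShortComplex.mk j (g n) w).ShortExact ∧
        Nonempty (Q ≅ (Scheme.Modules.pushforward (ι 0)).obj (F 0)))
    {V : X.Modules} (hV : IsFiniteLocallyFree V)
    (hG₀ : IsAffineLocalizing (sheafHom V ((Scheme.Modules.pushforward (ι 0)).obj (F 0))))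
    (hH1 : Subsingleton (CechMH1 f (sheafHom V ((Scheme.Modules.pushforward (ι 0)).obj (F 0))) U))
    (π : V ⟶ (Scheme.Modules.pushforward (ι 0)).obj (F 0)) [Epi π] :
    ∃ v : ∀ n, (Scheme.Modules.pullback (ι n)).obj V ⟶ F n, (∀ n, Epi (v n)) ∧
      ∀ n, (Scheme.Modules.pullback (t n)).map (v (n + 1)) ≫ (s n).hom =
        ((Scheme.Modules.pullbackComp (t n) (ι (n + 1))).app V ≪≫
          (Scheme.Modules.pullbackCongr (ht n)).app V).hom ≫ v n := by
  -- one step up the tower, on `X`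
  have step : ∀ (n : ℕ) (vn : V ⟶ (Scheme.Modules.pushforward (ι n)).obj (F n)), Epi vn →
      ∃ w : V ⟶ (Scheme.Modules.pushforward (ι (n + 1))).obj (F (n + 1)), Epi w ∧ w ≫ g n = vn := by
    intro n vn hvn
    obtain ⟨Q, j, w₀, hS, ⟨eQ⟩⟩ := hSES n
    have hQ : IsAffineLocalizing (sheafHom V Q) :=
      IsAffineLocalizing.of_iso ((sheafHomFunctor V).mapIso eQ.symm) hG₀
    have hH1Q : Subsingleton (CechMH1 f (sheafHom V Q) U) :=
      subsingleton_cechMH1_of_iso f U ((sheafHomFunctor V).mapIso eQ) hH1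
    obtain ⟨w, hw⟩ := exists_comp_eq_of_shortExact f U hUaff hUcov hV j (g n) w₀ hS hQ hH1Q vn
    exact ⟨w, epi_of_comp_eq_of_locally (g n) (a n) (hloc n) (hkill n) vn w hw, hw⟩
  -- the compatible system `vX n : V ⟶ ι_{n,*} F n` of epimorphisms
  let vX : ∀ n, {v : V ⟶ (Scheme.Modules.pushforward (ι n)).obj (F n) // Epi v} := fun n =>
    Nat.rec ⟨π, inferInstance⟩ (fun m vm =>
      ⟨Classical.choose (step m vm.1 vm.2), (Classical.choose_spec (step m vm.1 vm.2)).1⟩) n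
  have hvX : ∀ n, (vX (n + 1)).1 ≫ g n = (vX n).1 := fun n =>
    (Classical.choose_spec (step n (vX n).1 (vX n).2)).2
  -- transposes
  refine ⟨fun n => ((Scheme.Modules.pullbackPushforwardAdjunction (ι n)).homEquiv V (F n)).symm (vX n).1,
    fun n => ?_, fun n => ?_⟩
  · haveI := (vX n).2
    exact epi_homEquiv_symm_of_epi (ι n) _
  · exact transpose_restrict (t n) (ι (n + 1)) (ht n) V (F (n + 1)) (F n) (vX (n + 1)).1 (s n).hom
      (vX n).1 (by rw [← hvX n, hg n])

end Lift

/-! ### The kernel tower -/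

section Kernel

variable {Y₁ Y₂ : Scheme.{u}} (t : Y₁ ⟶ Y₂)

/-- **The kernels of a compatible pair of epimorphisms form a compatible pair.** For
`r : t^* E₂ ≅ E₁`, `s : t^* F₂ ≅ F₁` (`F₂` finite locally free), `v₂ : E₂ ↠ F₂`, `v₁ : E₁ ⟶ F₁` with
`t^* v₂ ≫ s = r ≫ v₁`, there is `κ : t^* ker v₂ ≅ ker v₁` with `κ ≫ (ker v₁ ↪ E₁) = t^*(ker v₂ ↪ E₂) ≫ r`
(`t^*` is exact on `0 → ker v₂ → E₂ → F₂ → 0`, tree `shortExact_map_pullback`). -/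
theorem exists_kernel_transition {E₂ F₂ : Y₂.Modules} {E₁ F₁ : Y₁.Modules}
    (r : (Scheme.Modules.pullback t).obj E₂ ≅ E₁) (hF₂ : IsFiniteLocallyFree F₂)
    (s : (Scheme.Modules.pullback t).obj F₂ ≅ F₁) (v₂ : E₂ ⟶ F₂) [Epi v₂] (v₁ : E₁ ⟶ F₁)
    (hC : (Scheme.Modules.pullback t).map v₂ ≫ s.hom = r.hom ≫ v₁) :
    ∃ κ : (Scheme.Modules.pullback t).obj (kernel v₂) ≅ kernel v₁,
      κ.hom ≫ kernel.ι v₁ = (Scheme.Modules.pullback t).map (kernel.ι v₂) ≫ r.hom := by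
  let S := ShortComplex.mk (kernel.ι v₂) v₂ (kernel.condition v₂)
  have hS : S.ShortExact := { exact := ShortComplex.exact_of_f_is_kernel _ (kernelIsKernel v₂) }
  have hS' := shortExact_map_pullback t hS hF₂
  haveI : Mono ((Scheme.Modules.pullback t).map (kernel.ι v₂)) := hS'.mono_f
  have hv : (Scheme.Modules.pullback t).map v₂ = r.hom ≫ v₁ ≫ s.inv := by
    rw [← Category.assoc, ← hC, Category.assoc, Iso.hom_inv_id, Category.comp_id]
  -- the two comparison maps
  let κf : (Scheme.Modules.pullback t).obj (kernel v₂) ⟶ kernel v₁ :=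
    kernel.lift v₁ ((Scheme.Modules.pullback t).map (kernel.ι v₂) ≫ r.hom) (by
      rw [Category.assoc, ← cancel_mono s.inv, Category.assoc, Category.assoc, ← hv,
        ← Functor.map_comp, kernel.condition, Functor.map_zero, zero_comp])
  have hκf : κf ≫ kernel.ι v₁ = (Scheme.Modules.pullback t).map (kernel.ι v₂) ≫ r.hom :=
    kernel.lift_ι _ _ _
  obtain ⟨κb, hκb⟩ := KernelFork.IsLimit.lift' hS'.fIsKernel (kernel.ι v₁ ≫ r.inv) (by
    change (kernel.ι v₁ ≫ r.inv) ≫ (Scheme.Modules.pullback t).map v₂ = 0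
    rw [hv, Category.assoc, Iso.inv_hom_id_assoc, kernel.condition_assoc, zero_comp])
  rw [Fork.ι_ofι] at hκb
  change κb ≫ (Scheme.Modules.pullback t).map (kernel.ι v₂) = kernel.ι v₁ ≫ r.inv at hκb
  refine ⟨⟨κf, κb, ?_, ?_⟩, hκf⟩
  · rw [← cancel_mono ((Scheme.Modules.pullback t).map (kernel.ι v₂)), Category.assoc, hκb,
      reassoc_of% hκf, Iso.hom_inv_id, Category.comp_id, Category.id_comp]
  · rw [← cancel_mono (kernel.ι v₁), Category.assoc, hκf, reassoc_of% hκb, Iso.inv_hom_id,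
      Category.comp_id, Category.id_comp]

/-- The kernel of an epimorphism from the restriction of a finite locally free module onto a finite
locally free module is finite locally free (`isFiniteLocallyFree_kernel`, `IsFiniteLocallyFree.pullback`). -/
theorem isFiniteLocallyFree_kernel_pullback {X' : Scheme.{u}} (i : Y₁ ⟶ X') {V : X'.Modules}
    (hV : IsFiniteLocallyFree V) {F : Y₁.Modules} (hF : IsFiniteLocallyFree F)
    (v : (Scheme.Modules.pullback i).obj V ⟶ F) [Epi v] : IsFiniteLocallyFree (kernel v) :=
  isFiniteLocallyFree_kernel v (hV.pullback i) hF

end Kernel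

/-- **Registered sub-goal** (helper stub of `stub_towerPresentation`, universe `0`): the kernel of an
epimorphism from the restriction of a finite locally free module onto a finite locally free module is
finite locally free (`isFiniteLocallyFree_kernel_pullback`). -/
theorem stub_kernelPullbackVectorBundle :
    ∀ (X Y : AlgebraicGeometry.Scheme.{0}) (i : Y ⟶ X) (V : X.Modules) (F : Y.Modules)
      (v : (AlgebraicGeometry.Scheme.Modules.pullback i).obj V ⟶ F),
      Literature.AlgebraicGeometry.Motives.IsFiniteLocallyFree V →
      Literature.AlgebraicGeometry.Motives.IsFiniteLocallyFree F → CategoryTheory.Epi v →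
        Literature.AlgebraicGeometry.Motives.IsFiniteLocallyFree (CategoryTheory.Limits.kernel v) :=
  fun _ _ i _ _ v hV hF _ => isFiniteLocallyFree_kernel_pullback i hV hF v

end Summit.HodgeConjecture.HodgeConjecture.Theorems.FormalVectorBundlesAlgebraize

end
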